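import Literature.Probability.RandomPlanarGeometry.SLEBubblesThm65Kappa
import Literature.Probability.RandomPlanarGeometry.HullHeightBound
import Literature.Probability.RandomPlanarGeometry.BubbleHittingHarmonic
import Literature.Analysis.FluidPDE.TaoRayChain
import Mathlib.MeasureTheory.Integral.IntervalIntegral.FundThmCalculus
import HarnessLib

/-!
# Lower bounds for the compensator `∫ m(A_t − W_t) dt` from one tracked point (line `boundary-area-law`, RS5c)

Line `boundary-area-law` of the crux `SubseqIdentification` (stmt-CriticalPhenomena-0783), restriction
reshape (lead c4, r-c4-3), stub RS5c `stub_compensatorNondegenerate`, reduced by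
`compensatorNondegenerate_of_unbounded` (file `…CompensatorReduction`) to the UNBOUNDEDNESS of the
compensator `L^A_∞ = ∫₀^∞ m(A_t − W_t) dt` (`m = starBubbleMass = −SΦ/6`, `A_t − W_t` the slid hull)
along hull-avoidance events. This file supplies the two DETERMINISTIC Loewner estimates that turn
lower bounds on `L^A_∞` into statements about the height `Im g_t(a)` of a single point `a ∈ A`:

* `isStarHull_invHull` — the inverted hull `{−1/z : z ∈ B}` of a `*`-hull is a `*`-hull;
* **`sq_div_le_starBubbleMass`** — THE MASS SEEN FROM ONE POINT: for `B ∈ 𝒬*` and `z ∈ B ∩ ℍ`,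
  `m(B) ≥ (Im z / |z|²)² / 2`. Indeed `m(B) = hcap({−1/z : z ∈ B})` ([LSW] (5.1),
  `starBubbleMass_eq_hcap`) and `hcap(K) ≥ (Im w)²/2` for every point `w` of a bounded hull `K`
  (Kemppainen–Smirnov Lemma A.13, `IsBoundedHull.im_sq_le_two_mul_hcap`), applied to `w = −1/z`,
  `Im(−1/z) = Im z/|z|²`;
* **`ofReal_sq_sub_le_lintegral_starBubbleMass`** — THE HEIGHT-DROP BOUND: for a continuous
  driving function `W`, `A ∈ 𝒬*` missed by the closed hull `K̂_{s₂}`, `a ∈ A ∩ ℍ` and `s₁ < s₂`,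
  `∫_{s₁}^{s₂} m(A_t − W_t) dt ≥ (Im g_{s₁}(a) − Im g_{s₂}(a))² / (8 (s₂ − s₁))`.
  Proof: `Z_t = g_t(a) − W_t`, `Y_t = Im Z_t` solves `Ẏ = −2Y/|Z|²` (Loewner's equation), so
  `Y_{s₁} − Y_{s₂} = ∫ 2Y/|Z|²`, while `m(A_t − W_t) ≥ (Y/|Z|²)²/2 = (2Y/|Z|²)²/8` pointwise
  (`Z_t ∈ A_t − W_t`); Cauchy–Schwarz `(∫ f)² ≤ (s₂ − s₁) ∫ f²` (the tree's `sq_intervalIntegral_le`) concludes. Stated for the real-time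
  Lebesgue integral (`…_Ioc`, any continuous `W`) and, for the SLE_κ driving function on paths whose
  hulls miss `A` forever, for the `timeMeasure` integral of the registered statements
  (`ofReal_sq_sub_le_lintegral_timeMeasure`).

So a proof of the remaining estimate (UNB) only has to make the height `Im g_t(a_i)` of many points
`a_i ∈ A` drop during pairwise disjoint short time windows on a hull-avoidance event (a corridor
forcing `γ` along `∂A`): `Σ_i Δ_i²/(8 δ_i)` is then a lower bound for `L^A_∞`.

References: G. F. Lawler, O. Schramm, W. Werner, *Conformal restriction: the chordal case*, J. Amer.
Math. Soc. 16 (2003), §5 (5.1); A. Kemppainen, S. Smirnov, *Random curves, scaling limits and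
Loewner evolutions*, Ann. Probab. 45 (2017), App. A Lemma A.13; G. F. Lawler, *Conformally Invariant
Processes in the Plane* (2005), Ch. 4 §4.1 (the Loewner flow). No named fact is used.
-/

noncomputable section

open MeasureTheory Filter Topology Set Metric
open scoped NNReal ENNReal
open Literature.Probability.RandomPlanarGeometry
open Literature.Probability.Process (preWienerMeasure)
open UpperHalfPlane (upperHalfPlaneSet)

namespace Summit.CriticalPhenomena.SAWScalingLimit.Theorems.SubseqIdentification.BoundaryAreaLaw

open Loewner

/-! ### The inverted hull of a `*`-hull and the mass seen from one point -/

section InvHull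

variable {B : Set ℂ}

/-- The inverted hull of a `*`-hull is closed (the image of a compact set off `0` under the
continuous inversion). [folklore] -/
theorem isClosed_invHull (h : IsStarHull B) : IsClosed (invHull B) := by
  rw [invHull_eq_image]
  refine (h.isBoundedHull.isCompact.image_of_continuousOn fun z hz ↦ ?_).isClosed
  have hz0 : z ≠ 0 := fun h0 ↦ h.zero_notMem (h0 ▸ hz)
  exact ((continuousAt_inv₀ hz0).neg).continuousWithinAt

/-- **The inverted hull `{−1/z : z ∈ B}` of a `*`-hull is a `*`-hull**: bounded (`B` is off a ball
about `0`), closed and the closure of its part in `ℍ` (inversion is a homeomorphism of `ℂ ∖ {0}`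
preserving `ℍ`), with simply connected complement in `ℍ` (conformal image of `ℍ ∖ B` under
`invEquiv`), and off `0`. [folklore] -/
theorem isStarHull_invHull (h : IsStarHull B) : IsStarHull (invHull B) := by
  obtain ⟨δ, hδ, hBδ⟩ := h.exists_pos_disjoint_ball
  refine ⟨⟨isBounded_closedBall.subset (invHull_subset_closedBall hδ hBδ), ?_, ?_⟩, ?_⟩
  · refine Subset.antisymm
      ((closure_mono inter_subset_left).trans (isClosed_invHull h).closure_subset) ?_
    intro w hw
    rw [mem_invHull_iff] at hw
    -- `z = −1/w ∈ B = cl(B ∩ ℍ)`, and `w = −1/z`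
    have hz0 : -w⁻¹ ≠ 0 := fun h0 ↦ h.zero_notMem (h0 ▸ hw)
    have hcl : -w⁻¹ ∈ closure (B ∩ upperHalfPlaneSet) := by
      rw [h.isBoundedHull.closure_inter_eq]; exact hw
    have hcont : ContinuousWithinAt (fun z : ℂ ↦ -z⁻¹) (B ∩ upperHalfPlaneSet) (-w⁻¹) :=
      ((continuousAt_inv₀ hz0).neg).continuousWithinAt
    have hmem := hcont.mem_closure_image hcl
    rw [neg_inv_neg_inv] at hmem
    refine closure_mono ?_ hmem
    rintro _ ⟨u, ⟨huB, huH⟩, rfl⟩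
    have hu0 : u ≠ 0 := fun h0 ↦ h.zero_notMem (h0 ▸ huB)
    refine ⟨?_, show 0 < (-u⁻¹).im from ?_⟩
    · rw [mem_invHull_iff, neg_inv_neg_inv]
      exact huB
    · rw [neg_inv_im]
      exact div_pos huH (Complex.normSq_pos.2 hu0)
  · exact (invEquiv B).isSimplyConnected_iff.1 h.isBoundedHull.2.2
  · rw [mem_invHull_iff, inv_zero, neg_zero]
    exact h.zero_notMem

/-- **THE MASS SEEN FROM ONE POINT: `m(B) ≥ (Im z/|z|²)²/2` for `z ∈ B ∩ ℍ`, `B ∈ 𝒬*`.**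
`m(B) = −SΦ_B(0)/6 = hcap({−1/z : z ∈ B})` ([LSW] (5.1)) and the half-plane capacity of a bounded
hull dominates `(Im w)²/2` for each of its points `w` (Kemppainen–Smirnov Lemma A.13), here
`w = −1/z` with `Im w = Im z/|z|²`.
[cite: LawlerSchrammWerner2003Restriction, §5 eq. (5.1)] [cite: KemppainenSmirnov2017, App. A Lemma A.13] -/
theorem sq_div_le_starBubbleMass (h : IsStarHull B) {z : ℂ} (hz : z ∈ B) (hzi : 0 < z.im) :
    (z.im / Complex.normSq z) ^ 2 / 2 ≤ starBubbleMass B := by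
  obtain ⟨δ, hδ, hBδ⟩ := h.exists_pos_disjoint_ball
  rw [starBubbleMass_eq_hcap h hδ hBδ]
  have hz0 : z ≠ 0 := fun h0 ↦ h.zero_notMem (h0 ▸ hz)
  have hw : -z⁻¹ ∈ invHull B := by rw [mem_invHull_iff, neg_inv_neg_inv]; exact hz
  have hwi : 0 < (-z⁻¹).im := by
    rw [neg_inv_im]
    exact div_pos hzi (Complex.normSq_pos.2 hz0)
  have key := IsBoundedHull.im_sq_le_two_mul_hcap (isStarHull_invHull h).isBoundedHull hw hwi
    ((hasRestrictionJet_starRMap h).isHydrodynamicMap_invertedMap (starDeriv_spec h).1)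
  rw [neg_inv_im] at key
  linarith

end InvHull

/-! ### The height-drop bound along the Loewner flow -/

section Window

variable {W : ℝ≥0 → ℝ} {A : Set ℂ}

/-- **THE HEIGHT-DROP BOUND (real time).** Let `W` be a continuous driving function, `A ∈ 𝒬*`
missed by the closed hull `K̂_{s₂}`, `a ∈ A ∩ ℍ`, `s₁ < s₂`. Then
`∫_{(s₁, s₂]} m(A_t − W_t) dt ≥ (Im g_{s₁}(a) − Im g_{s₂}(a))²/(8 (s₂ − s₁))`: with `Z_t = g_t(a) − W_t`,
`Y = Im Z`, Loewner's equation gives `Ẏ = −2Y/|Z|²`, so `Y_{s₁} − Y_{s₂} = ∫ 2Y/|Z|²`, and pointwise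
`m(A_t − W_t) ≥ (Y/|Z|²)²/2` (`sq_div_le_starBubbleMass`, `Z_t ∈ A_t − W_t ∈ 𝒬*`); conclude by
Cauchy–Schwarz. [cite: Lawler2005, Ch. 4 §4.1] -/
theorem ofReal_sq_sub_le_lintegral_starBubbleMass_Ioc (hW : Continuous W) (hA : IsStarHull A)
    {a : ℂ} (ha : a ∈ A) (hai : 0 < a.im) {s₁ s₂ : ℝ≥0} (hs : s₁ < s₂)
    (halive : Disjoint (closedHull W s₂) A) :
    ENNReal.ofReal (((map W s₁ a).im - (map W s₂ a).im) ^ 2 / (8 * ((s₂ : ℝ) - s₁))) ≤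
      ∫⁻ x in Ioc (s₁ : ℝ) s₂, ENNReal.ofReal (starBubbleMass (slidHull W A x.toNNReal)) := by
  -- the solution from `a`, alive beyond `s₂`
  have hT : (s₂ : WithTop ℝ≥0) < swallowingTime W a :=
    lt_swallowingTime_of_disjoint_closedHull hA.isBoundedHull.subset_closure halive ha
  have ha0 : a ≠ W 0 := fun h0 ↦ by
    have := congrArg Complex.im h0
    rw [Complex.ofReal_im] at this
    exact hai.ne' this
  obtain ⟨g, hg⟩ := exists_isSolution_swallowingTime_holds hW ha0
  set T := swallowingTime W a with hTdef
  set D : Set ℝ := {t : ℝ | 0 ≤ t ∧ (t.toNNReal : WithTop ℝ≥0) < T} with hD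
  have hs₂T : (((s₂ : ℝ)).toNNReal : WithTop ℝ≥0) < T := by rwa [Real.toNNReal_coe]
  have hIcc : Icc (0 : ℝ) s₂ ⊆ D := Icc_subset_timeDomain hs₂T
  have hsub : Icc (s₁ : ℝ) s₂ ⊆ D := fun x hx ↦ hIcc ⟨s₁.coe_nonneg.trans hx.1, hx.2⟩
  have hs' : (s₁ : ℝ) < s₂ := NNReal.coe_lt_coe.2 hs
  have hℓ : 0 < (s₂ : ℝ) - s₁ := sub_pos.2 hs'
  -- `Y`, `Z` and the rate `f = 2Y/|Z|²`
  set Y : ℝ → ℝ := fun x ↦ (g x).im with hY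
  set f : ℝ → ℝ := fun x ↦ 2 * (g x).im / Complex.normSq (g x - W x.toNNReal) with hf
  have hgc : ContinuousOn g (Icc (s₁ : ℝ) s₂) := hg.continuousOn.mono hsub
  have hWc : Continuous fun x : ℝ ↦ ((W x.toNNReal : ℝ) : ℂ) :=
    Complex.continuous_ofReal.comp (hW.comp continuous_real_toNNReal)
  have hZne : ∀ x ∈ Icc (s₁ : ℝ) s₂, g x - W x.toNNReal ≠ 0 := fun x hx ↦
    sub_ne_zero.2 (hg.ne (hsub hx).1 (hsub hx).2)
  have hYc : ContinuousOn Y (Icc (s₁ : ℝ) s₂) := Complex.continuous_im.comp_continuousOn hgc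
  have hfc : ContinuousOn f (Icc (s₁ : ℝ) s₂) := by
    refine ((continuousOn_const.mul hYc).div
      (Complex.continuous_normSq.comp_continuousOn (hgc.sub hWc.continuousOn)) fun x hx ↦ ?_)
    exact (Complex.normSq_pos.2 (hZne x hx)).ne'
  -- Loewner's equation for the height: `Ẏ = −f`
  have hderiv : ∀ x ∈ Ioo (s₁ : ℝ) s₂, HasDerivAt Y (-f x) x := by
    intro x hx
    have hx0 : 0 < x := s₁.coe_nonneg.trans_lt hx.1
    have hxT : (x.toNNReal : WithTop ℝ≥0) < T := (hsub (Ioo_subset_Icc_self hx)).2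
    have h1 := Complex.imCLM.hasFDerivAt.comp_hasDerivAt x (hg.hasDerivAt hx0 hxT)
    have h2 : (Complex.imCLM : ℂ →L[ℝ] ℝ) (vectorField W x (g x)) = -f x := by
      rw [Complex.imCLM_apply, im_vectorField, hf]
      ring
    rw [h2] at h1
    exact h1
  -- `Y s₁ − Y s₂ = ∫ f`
  have hfi : IntervalIntegrable f volume s₁ s₂ := hfc.intervalIntegrable_of_Icc hs'.le
  have hFTC : ∫ x in (s₁ : ℝ)..s₂, f x = Y s₁ - Y s₂ := by
    have h := intervalIntegral.integral_eq_sub_of_hasDerivAt_of_le hs'.le hYc hderiv hfi.neg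
    rw [intervalIntegral.integral_neg] at h
    linarith
  -- the values of the Loewner map
  have hmap : ∀ x ∈ Icc (s₁ : ℝ) s₂, map W x.toNNReal a = g x := fun x hx ↦ by
    rw [map_eq_of_isSolution hW hg (hsub hx).2, Real.coe_toNNReal _ (s₁.coe_nonneg.trans hx.1)]
  have hY₁ : (map W s₁ a).im = Y s₁ := by
    have := hmap s₁ (left_mem_Icc.2 hs'.le); rw [Real.toNNReal_coe] at this; rw [this]
  have hY₂ : (map W s₂ a).im = Y s₂ := by
    have := hmap s₂ (right_mem_Icc.2 hs'.le); rw [Real.toNNReal_coe] at this; rw [this]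
  -- pointwise: `f²/8 ≤ m(A_t − W_t)`
  have hpt : ∀ x ∈ Icc (s₁ : ℝ) s₂, f x ^ 2 / 8 ≤ starBubbleMass (slidHull W A x.toNNReal) := by
    intro x hx
    have hxle : x.toNNReal ≤ s₂ := by
      rw [← NNReal.coe_le_coe, Real.coe_toNNReal _ (s₁.coe_nonneg.trans hx.1)]; exact hx.2
    have halive' : Disjoint (closedHull W x.toNNReal) A :=
      halive.mono_left (closedHull_mono W hxle)
    have hstar : IsStarHull (slidHull W A x.toNNReal) := isStarHull_slidHull_of_disjoint hW hA halive'
    have hmem : g x - W x.toNNReal ∈ slidHull W A x.toNNReal :=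
      mem_slidHull_iff.2 ⟨a, ha, by rw [hmap x hx]⟩
    have him : 0 < (g x - W x.toNNReal).im := by
      rw [Complex.sub_im, Complex.ofReal_im, sub_zero]
      exact IsSolution.im_pos_holds hW hg hai x (hsub hx).1 (hsub hx).2
    have key := sq_div_le_starBubbleMass hstar hmem him
    have hfx : f x = 2 * ((g x - W x.toNNReal).im / Complex.normSq (g x - W x.toNNReal)) := by
      rw [hf, Complex.sub_im, Complex.ofReal_im, sub_zero]; ring
    rw [hfx]
    nlinarith [key]
  -- integrate
  have hf2i : IntervalIntegrable (fun x ↦ f x ^ 2 / 8) volume s₁ s₂ :=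
    ((hfc.pow 2).div_const 8).intervalIntegrable_of_Icc hs'.le
  have hCS := Literature.Analysis.FluidPDE.sq_intervalIntegral_le hs'.le hfc
  have hlow : ((map W s₁ a).im - (map W s₂ a).im) ^ 2 / (8 * ((s₂ : ℝ) - s₁)) ≤
      ∫ x in (s₁ : ℝ)..s₂, f x ^ 2 / 8 := by
    rw [hY₁, hY₂, ← hFTC, intervalIntegral.integral_div, div_le_iff₀ (by positivity)]
    calc (∫ x in (s₁ : ℝ)..s₂, f x) ^ 2 ≤ ((s₂ : ℝ) - s₁) * ∫ x in (s₁ : ℝ)..s₂, f x ^ 2 := hCS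
      _ = (∫ x in (s₁ : ℝ)..s₂, f x ^ 2) / 8 * (8 * ((s₂ : ℝ) - s₁)) := by ring
  have hnn : 0 ≤ᵐ[volume.restrict (Ioc (s₁ : ℝ) s₂)] fun x ↦ f x ^ 2 / 8 :=
    Eventually.of_forall fun x ↦ by positivity
  calc ENNReal.ofReal (((map W s₁ a).im - (map W s₂ a).im) ^ 2 / (8 * ((s₂ : ℝ) - s₁)))
      ≤ ENNReal.ofReal (∫ x in (s₁ : ℝ)..s₂, f x ^ 2 / 8) := ENNReal.ofReal_le_ofReal hlow
    _ = ∫⁻ x in Ioc (s₁ : ℝ) s₂, ENNReal.ofReal (f x ^ 2 / 8) := by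
        rw [intervalIntegral.integral_of_le hs'.le,
          ofReal_integral_eq_lintegral_ofReal ((intervalIntegrable_iff_integrableOn_Ioc_of_le hs'.le).1 hf2i) hnn]
    _ ≤ ∫⁻ x in Ioc (s₁ : ℝ) s₂, ENNReal.ofReal (starBubbleMass (slidHull W A x.toNNReal)) := by
        refine lintegral_mono_ae ?_
        filter_upwards [ae_restrict_mem measurableSet_Ioc] with x hx
        exact ENNReal.ofReal_le_ofReal (hpt x (Ioc_subset_Icc_self hx))

end Window

/-! ### The bound for the SLE_κ driving function, in the `timeMeasure` form of the registered statements -/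

section SLE

variable {κ : ℝ≥0} {A : Set ℂ}

/-- **THE HEIGHT-DROP BOUND FOR `L^A_∞` (SLE_κ driving function, `timeMeasure` form).** On a path
whose closed hulls miss the nonempty `A ∈ 𝒬*` at all times (a.s. the case on `{γ ∩ A = ∅}` for
`κ ≤ 4`, `ae_disjoint_closedHull_iff_lt_firstHit`), for `a ∈ A ∩ ℍ` and `s₁ < s₂`:
`∫₀^∞ m(A_t − W_t) dt ≥ (Im g_{s₁}(a) − Im g_{s₂}(a))²/(8 (s₂ − s₁))` — the total is `⨆_t L_t`
(`lintegral_timeMeasure_eq_iSup_LpK`), `L_{s₂} = ∫_{(0,s₂]} m ≥ ∫_{(s₁,s₂]} m`, and the real-time bound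
`ofReal_sq_sub_le_lintegral_starBubbleMass_Ioc` applies. [cite: Lawler2005, Ch. 4 §4.1] -/
theorem ofReal_sq_sub_le_lintegral_timeMeasure (hA : IsStarHull A) (hne : A.Nonempty) {ω : ℝ≥0 → ℝ}
    (hall : ∀ t, Disjoint (closedHull (sleDriving κ ω) t) A) {a : ℂ} (ha : a ∈ A) (hai : 0 < a.im)
    {s₁ s₂ : ℝ≥0} (hs : s₁ < s₂) :
    ENNReal.ofReal (((map (sleDriving κ ω) s₁ a).im - (map (sleDriving κ ω) s₂ a).im) ^ 2 /
        (8 * ((s₂ : ℝ) - s₁))) ≤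
      ∫⁻ t, ENNReal.ofReal (starBubbleMass (slidHull (sleDriving κ ω) A t)) ∂timeMeasure := by
  have hall' : ∀ t, Disjoint (closedHull (drvK κ (brownianCPath ω)) t) A := fun t ↦ by
    rw [drvK_brownianCPath]; exact hall t
  rw [lintegral_timeMeasure_eq_iSup_LpK hA hne hall']
  refine (ofReal_sq_sub_le_lintegral_starBubbleMass_Ioc (continuous_sleDriving κ ω) hA ha hai hs
    (hall s₂)).trans ((le_of_eq_of_le ?_ (lintegral_mono_set (μ := volume)
      (Ioc_subset_Ioc_left s₁.coe_nonneg))).trans (le_iSup (fun t ↦ LpK κ A t ω) s₂))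
  refine setLIntegral_congr_fun measurableSet_Ioc fun x _ ↦ ?_
  rw [MpK, MFnK_of_alive (hall' _), drvK_brownianCPath]

end SLE

/-! ### Registered forms -/

/-- **Registered helper `starBubbleMass_ge_of_mem`** (closed form of `sq_div_le_starBubbleMass`): for
every `B ∈ 𝒬*` and `z ∈ B ∩ ℍ`, `(Im z/|z|²)²/2 ≤ m(B)`.
[cite: LawlerSchrammWerner2003Restriction, §5 eq. (5.1)] [cite: KemppainenSmirnov2017, App. A Lemma A.13] -/
theorem starBubbleMass_ge_of_mem :
    ∀ (B : Set ℂ), IsStarHull B → ∀ (z : ℂ), z ∈ B → 0 < z.im →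
      (z.im / Complex.normSq z) ^ 2 / 2 ≤ starBubbleMass B :=
  fun _ hB _ hz hzi ↦ sq_div_le_starBubbleMass hB hz hzi

/-- **Registered helper `heightDrop_le_lintegral_Ioc`** (closed form of
`ofReal_sq_sub_le_lintegral_starBubbleMass_Ioc`): for every continuous driving function `W`, every
`A ∈ 𝒬*` missed by `K̂_{s₂}`, `a ∈ A ∩ ℍ`, `s₁ < s₂`:
`(Im g_{s₁}(a) − Im g_{s₂}(a))²/(8(s₂ − s₁)) ≤ ∫_{(s₁,s₂]} m(A_t − W_t) dt`. [cite: Lawler2005, Ch. 4 §4.1] -/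
theorem heightDrop_le_lintegral_Ioc :
    ∀ (W : ℝ≥0 → ℝ), Continuous W → ∀ (A : Set ℂ), IsStarHull A → ∀ (a : ℂ), a ∈ A → 0 < a.im →
      ∀ (s₁ s₂ : ℝ≥0), s₁ < s₂ → Disjoint (Loewner.closedHull W s₂) A →
        ENNReal.ofReal (((Loewner.map W s₁ a).im - (Loewner.map W s₂ a).im) ^ 2 / (8 * ((s₂ : ℝ) - s₁))) ≤
          ∫⁻ x in Set.Ioc (s₁ : ℝ) s₂, ENNReal.ofReal (starBubbleMass (Loewner.slidHull W A x.toNNReal)) :=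
  fun _ hW _ hA _ ha hai _ _ hs halive ↦
    ofReal_sq_sub_le_lintegral_starBubbleMass_Ioc hW hA ha hai hs halive

/-- **Registered helper `heightDrop_le_lintegral_timeMeasure`** (closed form of
`ofReal_sq_sub_le_lintegral_timeMeasure`): for the SLE_κ driving function on a path whose closed hulls
miss the nonempty `A ∈ 𝒬*` forever, `a ∈ A ∩ ℍ`, `s₁ < s₂`:
`(Im g_{s₁}(a) − Im g_{s₂}(a))²/(8(s₂ − s₁)) ≤ ∫₀^∞ m(A_t − W_t) dt` (the `timeMeasure` integral of the
registered statements of RS5c). [cite: Lawler2005, Ch. 4 §4.1] -/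
theorem heightDrop_le_lintegral_timeMeasure :
    ∀ (κ : ℝ≥0) (A : Set ℂ), IsStarHull A → A.Nonempty → ∀ (ω : ℝ≥0 → ℝ),
      (∀ t, Disjoint (Loewner.closedHull (sleDriving κ ω) t) A) → ∀ (a : ℂ), a ∈ A → 0 < a.im →
        ∀ (s₁ s₂ : ℝ≥0), s₁ < s₂ →
          ENNReal.ofReal (((Loewner.map (sleDriving κ ω) s₁ a).im - (Loewner.map (sleDriving κ ω) s₂ a).im) ^ 2 /
              (8 * ((s₂ : ℝ) - s₁))) ≤
            ∫⁻ t, ENNReal.ofReal (starBubbleMass (Loewner.slidHull (sleDriving κ ω) A t)) ∂timeMeasure :=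
  fun _ _ hA hne _ hall _ ha hai _ _ hs ↦ ofReal_sq_sub_le_lintegral_timeMeasure hA hne hall ha hai hs

end Summit.CriticalPhenomena.SAWScalingLimit.Theorems.SubseqIdentification.BoundaryAreaLaw

end
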